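import Summits.ResolutionOfSingularities.ResolutionOfSingularities.Theorems.FrobeniusLadderFInjectiveMacaulayficationHypersurfaceRegular
import Summits.ResolutionOfSingularities.ResolutionOfSingularities.Theorems.FrobeniusLadderFInjectiveMacaulayficationFiClauseOfRegular
import Summits.ResolutionOfSingularities.ResolutionOfSingularities.Theorems.FrobeniusLadderFInjectiveMacaulayficationDegreeZeroDescent
import Mathlib.Algebra.MvPolynomial.PDeriv
import Mathlib.Algebra.CharP.Algebra
import HarnessLib

/-!
# Regular points of a hypersurface chart satisfy the stalk clause (Jacobian certificate discharger)

Support file for crux stmt-ResolutionOfSingularities-15315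
(`FrobeniusLadder.FInjectiveMacaulayfication`, line `Sketch`, lead seat c7): stub
`stub_clauseOfPderivNotMem`.

The line certifies point blow-ups of hypersurfaces chart by chart. At a closed point `Q` of a chart
`k[X₀, …, Xₙ₋₁]/(g)` (a field `k` of prime characteristic `p`) where some partial derivative `∂g/∂Xⱼ`
does not vanish (`∂g/∂Xⱼ ∉ Q ∩ k[X]`), the local ring `(k[X]/(g))_Q` is a regular local ring by the
Jacobian criterion (`HypersurfaceRegular.stub_hypersurfaceRegularOfPderiv`, [Matsumura1987] Thm. 30.4);
it has characteristic `p` (`charP_of_injective_algebraMap` for the non-trivial `k`-algebra `k[X]/(g)`,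
then `DegreeZeroDescent.charP_localization_atPrime`), and regular local rings of prime characteristic
satisfy the per-stalk clause of the crux — every system of parameters is a weakly regular sequence and
generates a Frobenius closed ideal, inline form (`FiClauseOfRegular.stub_fiClauseOfRegular`).

This is the general (`Fin n`, prime `p`) form of the characteristic-`2`, `Fin 4` special case
`ThreefoldChart3Points.clause_of_pderiv_notMem`, whose proof it copies.

References: [Matsumura1987] H. Matsumura, *Commutative Ring Theory* (1987), Thm. 30.4, Thm. 14.3,
Thm. 17.4.
-/

-- single-problem summit: the doubled namespace component is forced
set_option linter.dupNamespace false

noncomputable section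

namespace Summit.ResolutionOfSingularities.ResolutionOfSingularities.Theorems.FInjectiveMacaulayfication.ClauseOfPderivNotMem

open MvPolynomial
open Summit.ResolutionOfSingularities.ResolutionOfSingularities.Theorems.FInjectiveMacaulayfication

/-- **The regular points of a hypersurface chart** (stub `stub_clauseOfPderivNotMem` of line `Sketch`).
For a prime `p`, a field `k` of characteristic `p`, a polynomial `g ∈ S = k[X₀, …, Xₙ₋₁]` and a maximal
ideal `Q` of `S/(g)` at which some partial derivative `∂g/∂Xⱼ` does not vanish (`∂g/∂Xⱼ ∉ Q ∩ S`), the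
local ring `(S/(g))_Q` satisfies the per-stalk clause (inline form, exponent `p`): it is a regular local
ring by the Jacobian criterion (`HypersurfaceRegular.stub_hypersurfaceRegularOfPderiv`) of
characteristic `p` (`DegreeZeroDescent.charP_localization_atPrime`), and regular local rings of prime
characteristic satisfy the clause (`FiClauseOfRegular.stub_fiClauseOfRegular`).
[cite: Matsumura1987, Thm. 30.4 (ii)] -/
theorem stub_clauseOfPderivNotMem : ∀ (p : ℕ) [Fact p.Prime] (k : Type) [Field k] [CharP k p] (n : ℕ) (g : MvPolynomial (Fin n) k)
    (Q : Ideal (MvPolynomial (Fin n) k ⧸ Ideal.span {g})) [Q.IsMaximal] (j : Fin n),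
    MvPolynomial.pderiv j g ∉ Q.comap (Ideal.Quotient.mk (Ideal.span {g})) →
    ∀ d : ℕ, ringKrullDim (Localization.AtPrime Q) = d → ∀ s : Fin d → Localization.AtPrime Q,
      (Ideal.span (Set.range s)).radical.IsMaximal →
        RingTheory.Sequence.IsWeaklyRegular (Localization.AtPrime Q) (List.ofFn s) ∧
        ∀ y : Localization.AtPrime Q, (∃ e : ℕ, y ^ p ^ e ∈ Ideal.span
          ((fun z : Localization.AtPrime Q => z ^ p ^ e) ''
            (Ideal.span (Set.range s) : Set (Localization.AtPrime Q)))) → y ∈ Ideal.span (Set.range s) := by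
  intro p _ k _ _ n g Q _ j hd
  haveI : IsRegularLocalRing (Localization.AtPrime Q) :=
    HypersurfaceRegular.stub_hypersurfaceRegularOfPderiv k n g j Q hd
  -- characteristic `p` passes to `S/(g)` (a non-trivial `k`-algebra) and to its localization
  haveI : Nontrivial (MvPolynomial (Fin n) k ⧸ Ideal.span {g}) :=
    nontrivial_of_ne (1 : MvPolynomial (Fin n) k ⧸ Ideal.span {g}) 0 fun h10 =>
      Ideal.IsMaximal.ne_top ‹_› ((Ideal.eq_top_iff_one Q).mpr (by rw [h10]; exact Q.zero_mem))
  haveI : CharP (MvPolynomial (Fin n) k ⧸ Ideal.span {g}) p :=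
    charP_of_injective_algebraMap
      (algebraMap k (MvPolynomial (Fin n) k ⧸ Ideal.span {g})).injective p
  haveI : CharP (Localization.AtPrime Q) p := DegreeZeroDescent.charP_localization_atPrime p Q
  exact (FiClauseOfRegular.stub_fiClauseOfRegular p (Localization.AtPrime Q)).2

end Summit.ResolutionOfSingularities.ResolutionOfSingularities.Theorems.FInjectiveMacaulayfication.ClauseOfPderivNotMem

end
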